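import Mathlib
import Summits.Ventures.HodgeRepro.Tier4.Target
import Summits.Ventures.HodgeRepro.Tier4.Line3.KMDatum

/-! # Tier4/Line3/Majorant — the FIRST RUNG of L3.4 / L3.5 (the majorant estimates R1–R5)

LINE L3 (t4-plan-3, Skeleton v0.9 S12190).  Filed by the prover seated on L3.5 (t4-L2-p3, lead S12234) from
t4-plan-3's `proofs/t4-plan-3/L3/RUNG-L3.5-v2.lean` (S12238; sha16 080ba6b91db16a0f · 282 l., farm rc 0 / 0 sorries):
the statements and proofs below are plan-3's, re-based on the LANDED `Tier4/Line3/KMDatum.lean` (`maj`, t4-L3-p1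
p661716) — the local copy of `maj` is dropped, nothing else changes.  Plan-3's description of the rung follows.

The off-main estimates of LINE L3 (L3.4 `term_tendsto_zero`, L3.5 `term_dominated`) rest on ONE analytic fact and ONE
arithmetic fact, both Mathlib-level and both about the FROZEN objects (`J`, `lift3`, `nsq`, `ball` of Target.lean and
the majorant `maj` of KMDatum / Skeleton v0.9 L232):

* ANALYTIC (R1–R4): the majorant `maj y z = (y,y)_J + 2|⟨z̃, Jy⟩|²/(1 − |z|²)` is the positive-definite form
  `‖y₊‖² + ‖y₋‖²` of the decomposition of `ℂ³` into the `J`-negative line `ℂ z̃` and its `J`-positive complement, so the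
  indefinite form is dominated by it: `|(y, y')_J| ≤ √(maj y z · maj y' z) ≤ (maj y z + maj y' z)/2` — UNIFORMLY in
  `z ∈ 𝔹`.  Consequently a tuple with ONE large Gram entry `|(x_i, x_j)_J| ≥ R` has `e^{−π maj(y_i,z)} e^{−π maj(y_j,z)}
  ≤ e^{−2πR}` at EVERY point of the ball (R4): the Gaussian of the kernel kills it on the whole domain at once.
* ARITHMETIC (R5): a non-zero element of `𝔭^N` has absolute norm `≥ N(𝔭)^N`, hence archimedean size `≥ N(𝔭)^{N/d}` at
  SOME embedding (product formula / `Algebra.norm_eq_prod_embeddings`).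

R1–R5 are ALL PROVED here (axioms = propext, Classical.choice, Quot.sound; no sorry).  Each is a genuine lemma of the
line; none restates L3.4 / L3.5 / `P_T4`.  Nothing here says anything about the status of the Hodge conjecture for CM
abelian varieties, which is NOT proved by anyone in this repository. -/
noncomputable section

namespace Summit.Ventures.HodgeRepro.Tier4.Line3

open Summit.Ventures.HodgeRepro.Tier4
open Matrix
open scoped ComplexConjugate
open NumberField

/-- `(y,y)_J = |y₀|² + |y₁|² − |y₂|²`. -/
theorem hformJ_re (y : Fin 3 → ℂ) :
    (star y ⬝ᵥ (J *ᵥ y)).re = ‖y 0‖ ^ 2 + ‖y 1‖ ^ 2 - ‖y 2‖ ^ 2 := by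
  simp [dotProduct, J, Matrix.mulVec_diagonal, Fin.sum_univ_three, Complex.sq_norm, Complex.normSq_apply,
    Complex.mul_re, Complex.conj_re, Complex.conj_im]
  ring

/-- `⟨z̃, Jy⟩ = z̄₀y₀ + z̄₁y₁ − y₂`. -/
theorem liftJ_eq (y : Fin 3 → ℂ) (z : Fin 2 → ℂ) :
    star (lift3 z) ⬝ᵥ (J *ᵥ y) = conj (z 0) * y 0 + conj (z 1) * y 1 - y 2 := by
  simp [dotProduct, J, lift3, Matrix.mulVec_diagonal, Fin.sum_univ_three]
  ring

/-- Lagrange: `s·p² − |u|² = |z̄₀y₁ − z̄₁y₀|²`. -/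
theorem lagrange (z : Fin 2 → ℂ) (y : Fin 3 → ℂ) :
    ‖conj (z 0) * y 0 + conj (z 1) * y 1‖ ^ 2 ≤ nsq z * (‖y 0‖ ^ 2 + ‖y 1‖ ^ 2) := by
  have h : nsq z * (‖y 0‖ ^ 2 + ‖y 1‖ ^ 2) - ‖conj (z 0) * y 0 + conj (z 1) * y 1‖ ^ 2
      = ‖z 0 * y 1 - z 1 * y 0‖ ^ 2 := by
    simp only [nsq, Complex.sq_norm, Complex.normSq_apply, Complex.add_re, Complex.add_im, Complex.sub_re,
      Complex.sub_im, Complex.mul_re, Complex.mul_im, Complex.conj_re, Complex.conj_im]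
    ring
  nlinarith [sq_nonneg ‖z 0 * y 1 - z 1 * y 0‖]

/-- **R1 (the positive part).** `(1 − |z|²)·(y,y)_J + |⟨z̃, Jy⟩|² ≥ (‖(y₀,y₁)‖ − |z|·|y₂|)² ≥ 0` for `z ∈ 𝔹`: the
`J`-orthogonal complement of the negative line `ℂ z̃` is positive (proof: expand with `J = diag(1,1,−1)`,
`u := z̄₀y₀ + z̄₁y₁`, `|u| ≤ |z|‖(y₀,y₁)‖` (Cauchy–Schwarz in `ℂ²`), `Re(u ȳ₂) ≤ |u||y₂|`, then
`(1−|z|²)(‖y′‖² − |y₂|²) + (|u| − |y₂|)² ≥ (‖y′‖ − |z||y₂|)²` by `nlinarith`). -/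
theorem rung_pos_part (y : Fin 3 → ℂ) (z : Fin 2 → ℂ) (hz : z ∈ ball) :
    0 ≤ (star y ⬝ᵥ (J *ᵥ y)).re + ‖star (lift3 z) ⬝ᵥ (J *ᵥ y)‖ ^ 2 / (1 - nsq z) := by
  have hs1 : nsq z < 1 := hz
  have hs0 : 0 ≤ nsq z := by unfold nsq; positivity
  rw [hformJ_re, liftJ_eq]
  set u := conj (z 0) * y 0 + conj (z 1) * y 1 with hu
  set s := nsq z with hsdef
  set p2 := ‖y 0‖ ^ 2 + ‖y 1‖ ^ 2 with hp2
  have hL : ‖u‖ ^ 2 ≤ s * p2 := lagrange z y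
  have hpos : 0 < 1 - s := by linarith
  -- |u − y₂|² = |u|² − 2 Re(u ȳ₂) + |y₂|², and 2 Re(u ȳ₂) ≤ 2 |u| |y₂|
  have hexp : ‖u - y 2‖ ^ 2 = ‖u‖ ^ 2 - 2 * (u * conj (y 2)).re + ‖y 2‖ ^ 2 := by
    simp only [Complex.sq_norm, Complex.normSq_apply, Complex.sub_re, Complex.sub_im, Complex.mul_re,
      Complex.conj_re, Complex.conj_im]
    ring
  have hre : (u * conj (y 2)).re ≤ ‖u‖ * ‖y 2‖ := by
    calc (u * conj (y 2)).re ≤ ‖u * conj (y 2)‖ := Complex.re_le_norm _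
      _ = ‖u‖ * ‖y 2‖ := by rw [norm_mul, Complex.norm_conj]
  have hp2nn : 0 ≤ p2 := by positivity
  have hq : 0 ≤ ‖y 2‖ := norm_nonneg _
  have hun : 0 ≤ ‖u‖ := norm_nonneg _
  have key : 0 ≤ (1 - s) * (p2 - ‖y 2‖ ^ 2) + ‖u - y 2‖ ^ 2 := by
    rw [hexp]
    rcases eq_or_lt_of_le hs0 with h0 | h0
    · have hu2 : ‖u‖ ^ 2 = 0 := le_antisymm (by rw [← h0] at hL; simpa using hL) (sq_nonneg _)
      have hu0 : ‖u‖ = 0 := (pow_eq_zero_iff two_ne_zero).mp hu2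
      have hrq : (u * conj (y 2)).re ≤ 0 := by rw [hu0, zero_mul] at hre; exact hre
      rw [hu0, ← h0]
      nlinarith [hrq, hp2nn]
    · have h3 : s * (u * conj (y 2)).re ≤ s * (‖u‖ * ‖y 2‖) := mul_le_mul_of_nonneg_left hre h0.le
      have hmul : 0 ≤ s * ((1 - s) * (p2 - ‖y 2‖ ^ 2) + (‖u‖ ^ 2 - 2 * (u * conj (y 2)).re + ‖y 2‖ ^ 2)) := by
        nlinarith [sq_nonneg (s * ‖y 2‖ - ‖u‖), mul_nonneg hpos.le (sub_nonneg.mpr hL), h3]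
      exact nonneg_of_mul_nonneg_right hmul h0
  have hrepr : p2 - ‖y 2‖ ^ 2 + ‖u - y 2‖ ^ 2 / (1 - s)
      = ((1 - s) * (p2 - ‖y 2‖ ^ 2) + ‖u - y 2‖ ^ 2) / (1 - s) := by
    field_simp
  rw [hrepr]
  exact div_nonneg key hpos.le

/-- **R2.** `|(y,y)_J| ≤ maj y z` on the ball (`maj − (y,y)_J = 2|⟨z̃,Jy⟩|²/(1−|z|²) ≥ 0`; `maj + (y,y)_J = 2·(R1) ≥ 0`). -/
theorem rung_abs_le_maj (y : Fin 3 → ℂ) (z : Fin 2 → ℂ) (hz : z ∈ ball) :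
    |(star y ⬝ᵥ (J *ᵥ y)).re| ≤ maj y z := by
  have hs : 0 < 1 - nsq z := by
    have : nsq z < 1 := hz
    linarith
  have hB : 0 ≤ ‖star (lift3 z) ⬝ᵥ (J *ᵥ y)‖ ^ 2 / (1 - nsq z) := by positivity
  have h1 := rung_pos_part y z hz
  unfold maj
  rw [abs_le]
  constructor
  · have : 2 * ‖star (lift3 z) ⬝ᵥ (J *ᵥ y)‖ ^ 2 / (1 - nsq z) =
        2 * (‖star (lift3 z) ⬝ᵥ (J *ᵥ y)‖ ^ 2 / (1 - nsq z)) := by ring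
    rw [this]; linarith
  · have : 2 * ‖star (lift3 z) ⬝ᵥ (J *ᵥ y)‖ ^ 2 / (1 - nsq z) =
        2 * (‖star (lift3 z) ⬝ᵥ (J *ᵥ y)‖ ^ 2 / (1 - nsq z)) := by ring
    rw [this]; linarith

/-! Sesquilinearity of `(y, y')_J = star y ⬝ᵥ (J *ᵥ y')` and hermitian symmetry (`J` is real diagonal). -/
/-- `(y₁ + y₂, y')_J = (y₁, y')_J + (y₂, y')_J`. -/
theorem B_add_left (y₁ y₂ y' : Fin 3 → ℂ) :
    star (y₁ + y₂) ⬝ᵥ (J *ᵥ y') = star y₁ ⬝ᵥ (J *ᵥ y') + star y₂ ⬝ᵥ (J *ᵥ y') := by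
  simp [star_add, add_dotProduct]

/-- `(y₁ − y₂, y')_J = (y₁, y')_J − (y₂, y')_J`. -/
theorem B_sub_left (y₁ y₂ y' : Fin 3 → ℂ) :
    star (y₁ - y₂) ⬝ᵥ (J *ᵥ y') = star y₁ ⬝ᵥ (J *ᵥ y') - star y₂ ⬝ᵥ (J *ᵥ y') := by
  simp [star_sub, sub_dotProduct]

/-- `(y, y₁ + y₂)_J = (y, y₁)_J + (y, y₂)_J`. -/
theorem B_add_right (y y₁ y₂ : Fin 3 → ℂ) :
    star y ⬝ᵥ (J *ᵥ (y₁ + y₂)) = star y ⬝ᵥ (J *ᵥ y₁) + star y ⬝ᵥ (J *ᵥ y₂) := by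
  simp [Matrix.mulVec_add, dotProduct_add]

/-- `(y, y₁ − y₂)_J = (y, y₁)_J − (y, y₂)_J`. -/
theorem B_sub_right (y y₁ y₂ : Fin 3 → ℂ) :
    star y ⬝ᵥ (J *ᵥ (y₁ - y₂)) = star y ⬝ᵥ (J *ᵥ y₁) - star y ⬝ᵥ (J *ᵥ y₂) := by
  simp [Matrix.mulVec_sub, dotProduct_sub]

/-- `(y, c • y')_J = c · (y, y')_J` (linear in the second slot). -/
theorem B_smul_right (c : ℂ) (y y' : Fin 3 → ℂ) :
    star y ⬝ᵥ (J *ᵥ (c • y')) = c * (star y ⬝ᵥ (J *ᵥ y')) := by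
  simp [Matrix.mulVec_smul, dotProduct_smul]

/-- `(c • y, y')_J = conj c · (y, y')_J` (conjugate-linear in the first slot). -/
theorem B_smul_left (c : ℂ) (y y' : Fin 3 → ℂ) :
    star (c • y) ⬝ᵥ (J *ᵥ y') = conj c * (star y ⬝ᵥ (J *ᵥ y')) := by
  simp [star_smul, smul_dotProduct]

/-- Hermitian symmetry: `(y', y)_J = conj (y, y')_J` (`J` is real diagonal). -/
theorem B_conj (y y' : Fin 3 → ℂ) :
    star y' ⬝ᵥ (J *ᵥ y) = conj (star y ⬝ᵥ (J *ᵥ y')) := by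
  simp [dotProduct, J, Matrix.mulVec_diagonal, Fin.sum_univ_three, map_add, map_mul, map_neg]
  ring

/-- the real part of the indefinite form is dominated by the mean of the majorants -/
theorem rung_re_le_maj (y y' : Fin 3 → ℂ) (z : Fin 2 → ℂ) (hz : z ∈ ball) :
    |(star y ⬝ᵥ (J *ᵥ y')).re| ≤ (maj y z + maj y' z) / 2 := by
  have hs1 : nsq z < 1 := hz
  have hpos : 0 < 1 - nsq z := by linarith
  -- polarisation of the real part
  have hp : (star (y + y') ⬝ᵥ (J *ᵥ (y + y'))).re
      = (star y ⬝ᵥ (J *ᵥ y)).re + 2 * (star y ⬝ᵥ (J *ᵥ y')).re + (star y' ⬝ᵥ (J *ᵥ y')).re := by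
    rw [B_add_left, B_add_right, B_add_right, B_conj y y']
    simp only [Complex.add_re, Complex.conj_re]
    ring
  have hm : (star (y - y') ⬝ᵥ (J *ᵥ (y - y'))).re
      = (star y ⬝ᵥ (J *ᵥ y)).re - 2 * (star y ⬝ᵥ (J *ᵥ y')).re + (star y' ⬝ᵥ (J *ᵥ y')).re := by
    rw [B_sub_left, B_sub_right, B_sub_right, B_conj y y']
    simp only [Complex.sub_re, Complex.conj_re]
    ring
  -- parallelogram law for the linear functional ⟨z̃, J ·⟩
  have hL : ‖star (lift3 z) ⬝ᵥ (J *ᵥ (y + y'))‖ ^ 2 + ‖star (lift3 z) ⬝ᵥ (J *ᵥ (y - y'))‖ ^ 2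
      = 2 * ‖star (lift3 z) ⬝ᵥ (J *ᵥ y)‖ ^ 2 + 2 * ‖star (lift3 z) ⬝ᵥ (J *ᵥ y')‖ ^ 2 := by
    rw [B_add_right, B_sub_right]
    have := parallelogram_law_with_norm ℂ (star (lift3 z) ⬝ᵥ (J *ᵥ y)) (star (lift3 z) ⬝ᵥ (J *ᵥ y'))
    nlinarith [this]
  have hpar : maj (y + y') z + maj (y - y') z = 2 * maj y z + 2 * maj y' z := by
    unfold maj
    rw [hp, hm]
    field_simp
    nlinarith [hL]
  have h1 := rung_abs_le_maj (y + y') z hz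
  have h2 := rung_abs_le_maj (y - y') z hz
  rw [abs_le] at h1 h2 ⊢
  constructor <;> nlinarith [h1.1, h1.2, h2.1, h2.2, hpar, hp, hm]

/-- The majorant is invariant under unit scalars: `maj (c • y) z = maj y z` for `‖c‖ = 1` (the same statement as
the landed `KMDatum.maj_smul`, kept here with plan-3's proof through the sesquilinearity lemmas). -/
theorem maj_smul_unit (c : ℂ) (hc : ‖c‖ = 1) (y : Fin 3 → ℂ) (z : Fin 2 → ℂ) :
    maj (c • y) z = maj y z := by
  unfold maj
  rw [B_smul_left, B_smul_right, B_smul_right, norm_mul, hc, one_mul]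
  have : conj c * (c * (star y ⬝ᵥ (J *ᵥ y))) = (star y ⬝ᵥ (J *ᵥ y)) := by
    rw [← mul_assoc, Complex.conj_mul', hc]
    simp
  rw [this]

/-- **R3 (Cauchy–Schwarz against the majorant).** `‖(y, y')_J‖ ≤ (maj y z + maj y' z)/2` on the ball.
Proof: `(y,y')_J = m₊(y,y') − m₋(y,y')` with `m₋(y,y') := conj⟨z̃,Jy⟩·⟨z̃,Jy'⟩/(1−|z|²)` (rank one, positive) and
`m₊ := (·,·)_J + m₋` (positive by R1 polarised); Cauchy–Schwarz for each positive hermitian form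
(`discrim_le_zero` on `t ↦ m(y + t y')`), then `√(ab) + √(cd) ≤ √((a+c)(b+d)) ≤ ((a+c)+(b+d))/2`.
SHORTER (from R2 alone): polarise — `4 Re(y,y')_J = (y+y',y+y')_J − (y−y',y−y')_J`, so by R2 and the parallelogram
law of the hermitian quadratic form `maj` (`maj (y+y') z + maj (y−y') z = 2 maj y z + 2 maj y' z`),
`|Re (y,y')_J| ≤ (maj y z + maj y' z)/2`; rotate `y'` by the phase `e^{iθ}` making `(y, e^{iθ}y')_J` real
(`maj (e^{iθ} y') z = maj y' z`) to get the modulus. -/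
theorem rung_hform_le_maj (y y' : Fin 3 → ℂ) (z : Fin 2 → ℂ) (hz : z ∈ ball) :
    ‖star y ⬝ᵥ (J *ᵥ y')‖ ≤ (maj y z + maj y' z) / 2 := by
  set w := star y ⬝ᵥ (J *ᵥ y') with hw
  by_cases h0 : w = 0
  · rw [h0, norm_zero]
    have hy := rung_abs_le_maj y z hz
    have hy' := rung_abs_le_maj y' z hz
    have := abs_nonneg (star y ⬝ᵥ (J *ᵥ y)).re
    have := abs_nonneg (star y' ⬝ᵥ (J *ᵥ y')).re
    linarith
  · set c : ℂ := conj w / (‖w‖ : ℂ) with hc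
    have hw0 : (‖w‖ : ℂ) ≠ 0 := by exact_mod_cast norm_ne_zero_iff.mpr h0
    have hc1 : ‖c‖ = 1 := by
      rw [hc, norm_div, Complex.norm_conj, Complex.norm_real, norm_norm, div_self (norm_ne_zero_iff.mpr h0)]
    have hcw : (star y ⬝ᵥ (J *ᵥ (c • y'))).re = ‖w‖ := by
      rw [B_smul_right, ← hw, hc, div_mul_eq_mul_div, Complex.conj_mul']
      have : ((‖w‖ : ℂ) ^ 2) / (‖w‖ : ℂ) = (‖w‖ : ℂ) := by
        rw [pow_two, mul_div_assoc, div_self hw0, mul_one]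
      rw [this, Complex.ofReal_re]
    have := rung_re_le_maj y (c • y') z hz
    rw [hcw, maj_smul_unit c hc1] at this
    exact (le_abs_self _).trans this

/-- **R4 (one large Gram entry kills the Gaussian everywhere on the ball).** -/
theorem rung_gaussian_small (y y' : Fin 3 → ℂ) (z : Fin 2 → ℂ) (hz : z ∈ ball) (R : ℝ)
    (hR : R ≤ ‖star y ⬝ᵥ (J *ᵥ y')‖) :
    Real.exp (-Real.pi * maj y z) * Real.exp (-Real.pi * maj y' z) ≤ Real.exp (-(2 * Real.pi * R)) := by
  rw [← Real.exp_add]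
  apply Real.exp_le_exp.mpr
  have h := rung_hform_le_maj y y' z hz
  have hpi : 0 < Real.pi := Real.pi_pos
  nlinarith

/-- **R5 (arithmetic size of a deep congruence).** A non-zero element of `𝔭^N` of a number field `E` of degree `d` is
large at some embedding: `∃ σ, N(𝔭)^N ≤ ‖σ α‖^d` (its absolute norm is a non-zero multiple of `absNorm 𝔭^N`:
`Ideal.absNorm_dvd_absNorm_of_le` on `span {α} ≤ 𝔭^N`, `Ideal.absNorm_span_singleton`; the norm is the product of the
`d` embeddings, `Algebra.norm_eq_prod_embeddings`, so the largest factor is `≥ |N(α)|^{1/d}`). -/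
theorem rung_archimedean_size (E : Type) [Field E] [NumberField E]
    (p : IsDedekindDomain.HeightOneSpectrum (RingOfIntegers E)) (N : ℕ)
    (α : RingOfIntegers E) (hα : α ∈ p.asIdeal ^ N) (h0 : α ≠ 0) :
    ∃ σ : E →+* ℂ, ((Ideal.absNorm p.asIdeal : ℝ) ^ N) ≤ ‖σ α‖ ^ Module.finrank ℚ E := by
  -- (1) the absolute norm of 𝔭^N divides |N(α)| ≠ 0
  have hdvd : Ideal.absNorm (p.asIdeal ^ N) ∣ Ideal.absNorm (Ideal.span {α}) :=
    Ideal.absNorm_dvd_absNorm_of_le ((Ideal.span_singleton_le_iff_mem _).mpr hα)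
  rw [Ideal.absNorm_span_singleton, map_pow] at hdvd
  have hne : (Algebra.norm ℤ α).natAbs ≠ 0 := by
    rw [Int.natAbs_ne_zero]
    exact (Algebra.norm_ne_zero_iff (R := ℤ)).mpr h0
  have hle : (Ideal.absNorm p.asIdeal) ^ N ≤ (Algebra.norm ℤ α).natAbs :=
    Nat.le_of_dvd (Nat.pos_of_ne_zero hne) hdvd
  -- (2) |N(α)| = ∏_σ ‖σ α‖ over the `d` embeddings
  have hprod : ((Algebra.norm ℤ α).natAbs : ℝ) = ∏ σ : E →+* ℂ, ‖σ α‖ := by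
    have h1 : ((Algebra.norm ℤ α : ℤ) : ℂ) = ∏ σ : E →+* ℂ, σ α := by
      have := Algebra.norm_eq_prod_embeddings ℂ (α : E) (K := ℚ)
      have hq : ((Algebra.norm ℤ α : ℤ) : ℂ) = algebraMap ℚ ℂ (Algebra.norm ℚ (α : E)) := by
        rw [← Algebra.coe_norm_int]
        simp
      rw [hq, this]
      exact (Fintype.prod_equiv (RingHom.equivRatAlgHom) _ _ (fun σ => rfl)).symm
    have h2 : (((Algebra.norm ℤ α).natAbs : ℕ) : ℝ) = ‖((Algebra.norm ℤ α : ℤ) : ℂ)‖ := by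
      rw [Nat.cast_natAbs, Complex.norm_intCast, Int.cast_abs]
    rw [h2, h1, norm_prod]
  -- (3) the largest factor
  obtain ⟨σ₀, -, hσ₀⟩ := Finset.exists_max_image Finset.univ (fun σ : E →+* ℂ => ‖σ α‖) Finset.univ_nonempty
  refine ⟨σ₀, ?_⟩
  have hcard : Fintype.card (E →+* ℂ) = Module.finrank ℚ E := NumberField.Embeddings.card E ℂ
  have hbound : ∏ σ : E →+* ℂ, ‖σ α‖ ≤ ‖σ₀ α‖ ^ Module.finrank ℚ E := by
    calc ∏ σ : E →+* ℂ, ‖σ α‖ ≤ ∏ _σ : E →+* ℂ, ‖σ₀ α‖ :=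
          Finset.prod_le_prod (fun _ _ => norm_nonneg _) (fun σ _ => hσ₀ σ (Finset.mem_univ σ))
      _ = ‖σ₀ α‖ ^ Fintype.card (E →+* ℂ) := by rw [Finset.prod_const, Finset.card_univ]
      _ = ‖σ₀ α‖ ^ Module.finrank ℚ E := by rw [hcard]
  calc ((Ideal.absNorm p.asIdeal : ℝ) ^ N) = ((Ideal.absNorm p.asIdeal ^ N : ℕ) : ℝ) := by push_cast; rfl
    _ ≤ ((Algebra.norm ℤ α).natAbs : ℝ) := by exact_mod_cast hle
    _ = ∏ σ : E →+* ℂ, ‖σ α‖ := hprod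
    _ ≤ ‖σ₀ α‖ ^ Module.finrank ℚ E := hbound

end Summit.Ventures.HodgeRepro.Tier4.Line3
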